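import Summits.BirchSwinnertonDyer.Rank1Residual.X2.HeegnerTamagawaOdd
import HarnessLib

/-!
# Route `CMKolyvaginAtInertTwo`, crux `CMKolyvaginExactAtInertTwo` (stmt-BirchSwinnertonDyer-24277):
# THE COUNT IDENTITY `#Ш(E/K)[2^∞] = #Ш(E/ℚ)[2^∞] · #Ш(E^{(d_K)}/ℚ)[2^∞]`, IIIa —
# Tamagawa numbers under base change to a HEEGNER field: `∏_w c_w(E/K) = (∏_ℓ c_ℓ(E/ℚ))²`, at EVERY
# prime, including `2`

Seat `bsd-line-cmk2-p1` g15 (cell `bsd-print-cf2`); helper (`--supports stmt-BirchSwinnertonDyer-24277`).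
THEOREMS ONLY: no definition, no named fact, no `sorry`; no item is closed; BSD is not proved by this.

The tree's `X2.padicValNat_tamagawaProduct_baseChange_of_heegner_odd` (cell `bsd-eis`) proves
`ord_p ∏_w c_w(E/K) = 2 · ord_p ∏_ℓ c_ℓ(E)` at ODD `p` by way of the per-place identity with the
TWIST `E^{(d_K)}` as the third curve (whose Tamagawa number at a ramified prime is a `2`-power and
spoils the identity at `p = 2`). The base-change half needs no twist and no parity: on a field in
which every prime of the conductor splits (the Heegner hypothesis), a place `v` of `ℚ` either splits
— two places of degree one above it, each with `c_w(E_K) = c_v(E)`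
(`X11b.localTamagawaNumber_baseChange_eq_of_degree_one`) — or is good for `E` and for `E_K`
(`c = 1`). Feeding the per-place identity with `E` ITSELF as the third curve to x11b3's assembly
`X11b.Three.padicValNat_tamagawaProduct_baseChange_of_fibrewise` gives the square at every prime,
hence the equality of natural numbers.

* `sum_fibre_padicValNat_localTamagawaNumber_of_heegner` — per place, every `p`:
  `Σ_{w ∣ v} ord_p c_w(E_K) = ord_p c_v(E) + ord_p c_v(E)`;
* `padicValNat_tamagawaProduct_baseChange_of_heegner` — `ord_p ∏_w c_w(E/K) = 2·ord_p ∏_ℓ c_ℓ(E)`,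
  every prime `p`;
* `tamagawaProduct_baseChange_eq_sq_of_heegner` — **`∏_w c_w(E/K) = (∏_ℓ c_ℓ(E))²`**.

References: Jetchev–Skinner–Wan 2017 §7.4.1 (eq:tamK); Gross 1991 (*Kolyvagin's work*) §2 (the
Heegner hypothesis); Silverman *AEC* VII.6, *ATAEC* IV.9.
-/

-- single-conjunct summit: `Summit.BirchSwinnertonDyer.BirchSwinnertonDyer.…` repeats the name by design
set_option linter.dupNamespace false
set_option autoImplicit false

noncomputable section

open scoped Classical

open WeierstrassCurve NumberField IsDedekindDomain Literature.NumberTheory.EllipticCurves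
  Literature.NumberTheory.QuadraticFields Literature.NumberTheory.EllipticCurves.Rank1Residual
  Summit.BirchSwinnertonDyer.Rank1Residual.X11b Summit.BirchSwinnertonDyer.Rank1Residual

namespace Summit.BirchSwinnertonDyer.BirchSwinnertonDyer.Theorems.ShaCountTwo

/-- **The base-change Tamagawa relation one rational place at a time, at EVERY prime `p`, on a field
in which every bad prime splits.** For `W/ℚ` globally minimal elliptic of conductor `N`, `K` a
quadratic field in which every prime of `N` splits, and a finite place `v ↔ ℓ` of `ℚ`:
`Σ_{w ∣ v} ord_p c_w(E_K) = ord_p c_v(E) + ord_p c_v(E)`. Split `v`: both places above have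
`c_w = c_v(E)` (degree one, `X11b.localTamagawaNumber_baseChange_eq_of_degree_one`). Non-split `v`:
`ℓ ∤ N`, so `E` is good at `v` and `E_K` at the place above (`c = 1`). No parity of `p` and no twist
enters. [cite: JetchevSkinnerWan2017, §7.4.1 (eq:tamK) (pp. 29–31)]
[cite: SilvermanATAEC1994, Cor. IV.9.2(d)] -/
theorem sum_fibre_padicValNat_localTamagawaNumber_of_heegner (W : WeierstrassCurve ℚ) [W.IsElliptic]
    [W.IsGloballyMinimal] (p : ℕ) (K : Type) [Field K] [NumberField K]
    [(W.baseChange K).IsElliptic] (h2 : Module.finrank ℚ K = 2)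
    (hH : SatisfiesHeegnerHypothesis (W.conductorNorm ℤ) K) (v : HeightOneSpectrum (𝓞 ℚ)) :
    (∑ w ∈ (HeightOneSpectrum.finite_setOf_under_eq_of_numberField (K := K) v).toFinset,
        padicValNat p (((W.baseChange K).baseChange (w.adicCompletion K)).localTamagawaNumber
          (w.adicCompletionIntegers K))) =
      padicValNat p ((W.baseChange (v.adicCompletion ℚ)).localTamagawaNumber
          (v.adicCompletionIntegers ℚ)) +
        padicValNat p ((W.baseChange (v.adicCompletion ℚ)).localTamagawaNumber
          (v.adicCompletionIntegers ℚ)) := by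
  set ℓ : ℕ := (Rat.HeightOneSpectrum.primesEquiv v : ℕ) with hℓdef
  haveI hℓ : Fact ℓ.Prime := ⟨(Rat.HeightOneSpectrum.primesEquiv v).2⟩
  have hvℓ : (Rat.HeightOneSpectrum.primesEquiv v : ℕ) = ℓ := rfl
  have hfin := HeightOneSpectrum.finite_setOf_under_eq_of_numberField (K := K) v
  -- the case of a single place `w` above `v` (inert or ramified): `ℓ ∤ N`, everything is `1`
  have key : ∀ (w : HeightOneSpectrum (𝓞 K)),
      {w' : HeightOneSpectrum (𝓞 K) | w'.under (𝓞 ℚ) = v} = {w} →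
      (∑ w ∈ hfin.toFinset,
          padicValNat p (((W.baseChange K).baseChange (w.adicCompletion K)).localTamagawaNumber
            (w.adicCompletionIntegers K)) =
        padicValNat p ((W.baseChange (v.adicCompletion ℚ)).localTamagawaNumber
            (v.adicCompletionIntegers ℚ)) +
          padicValNat p ((W.baseChange (v.adicCompletion ℚ)).localTamagawaNumber
            (v.adicCompletionIntegers ℚ))) := by
    intro w hset
    have hw : w.under (𝓞 ℚ) = v := by
      have h : w ∈ ({w} : Set (HeightOneSpectrum (𝓞 K))) := Set.mem_singleton _
      rwa [← hset] at h
    haveI : w.asIdeal.LiesOver v.asIdeal := ⟨by rw [← hw]; rfl⟩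
    have hF : hfin.toFinset = {w} := by
      ext w'
      rw [Set.Finite.mem_toFinset, hset]
      simp
    -- `ℓ` does not split in `K`, hence (Heegner hypothesis) `ℓ ∤ N`
    have hns : ¬ SplitsIn K ℓ := by
      show ((Ideal.span {(ℓ : ℤ)}).primesOver (𝓞 K)).ncard ≠ 2
      rw [hℓdef, ncard_primesOver_span_eq K v, hset, Set.ncard_singleton]
      decide
    have hℓN : ¬ ℓ ∣ W.conductorNorm ℤ := fun hℓN => hns (hH ℓ hℓ.out hℓN)
    have hgood : W.HasGoodReductionAt v :=
      (hasGoodReductionAtPrime_primesEquiv_iff_holds W v ℓ hvℓ).mp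
        (by
          by_contra hbad'
          exact hℓN ((W.dvd_conductorNorm_iff_not_hasGoodReductionAtPrime ℓ).mpr hbad'))
    have hQ : padicValNat p ((W.baseChange (v.adicCompletion ℚ)).localTamagawaNumber
        (v.adicCompletionIntegers ℚ)) = 0 := by
      rw [localTamagawaNumber_eq_one_of_good' v W
        (WeierstrassCurve.localTamagawaNumber_eq_one_of_hasGoodReduction_holds _ _) hgood]
      simp
    have hgoodK : (W.baseChange K).HasGoodReductionAt w :=
      hasGoodReductionAt_baseChange_of_hasGoodReductionAt_rat W v w hgood
    have hKw : padicValNat p (((W.baseChange K).baseChange (w.adicCompletion K)).localTamagawaNumber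
        (w.adicCompletionIntegers K)) = 0 := by
      rw [localTamagawaNumber_eq_one_of_good' w (W.baseChange K)
        (WeierstrassCurve.localTamagawaNumber_eq_one_of_hasGoodReduction_holds _ _) hgoodK]
      simp
    rw [hF, Finset.sum_singleton, hKw, hQ]
  rcases placesOver_trichotomy_of_finrank_eq_two K h2 v with
    ⟨w₁, w₂, hne, hset, hef⟩ | ⟨w, hset, -, -⟩ | ⟨w, hset, -, -⟩
  · -- split: two places of degree one
    have hw₁ : w₁.under (𝓞 ℚ) = v := by
      have h : w₁ ∈ ({w₁, w₂} : Set (HeightOneSpectrum (𝓞 K))) := Set.mem_insert _ _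
      rwa [← hset] at h
    have hw₂ : w₂.under (𝓞 ℚ) = v := by
      have h : w₂ ∈ ({w₁, w₂} : Set (HeightOneSpectrum (𝓞 K))) :=
        Set.mem_insert_of_mem _ (Set.mem_singleton _)
      rwa [← hset] at h
    obtain ⟨he₁, hf₁⟩ := hef w₁ hw₁
    obtain ⟨he₂, hf₂⟩ := hef w₂ hw₂
    have hF : hfin.toFinset = {w₁, w₂} := by
      ext w
      rw [Set.Finite.mem_toFinset, hset]
      simp
    have c₁ := localTamagawaNumber_baseChange_eq_of_degree_one W w₁ he₁ hf₁
    have c₂ := localTamagawaNumber_baseChange_eq_of_degree_one W w₂ he₂ hf₂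
    rw [hw₁] at c₁
    rw [hw₂] at c₂
    rw [hF, Finset.sum_pair hne, c₁, c₂]
  · exact key w hset
  · exact key w hset

/-- **`ord_p ∏_w c_w(E/K) = 2 · ord_p ∏_ℓ c_ℓ(E)` at EVERY prime `p` (including `2`) on a quadratic
field in which every bad prime of `E` splits** (`W/ℚ` globally minimal): the per-place identity
`sum_fibre_padicValNat_localTamagawaNumber_of_heegner` with `E` itself as the third curve, assembled
by x11b3's `X11b.Three.padicValNat_tamagawaProduct_baseChange_of_fibrewise`. Jetchev–Skinner–Wan 2017
(eq:tamK) "`∏_w c_w(E/K) = ∏_ℓ c_ℓ(E/ℚ)²`", read `p`-adically.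
[cite: JetchevSkinnerWan2017, §7.4.1 (eq:tamK) (pp. 29–31)] -/
theorem padicValNat_tamagawaProduct_baseChange_of_heegner (W : WeierstrassCurve ℚ) [W.IsElliptic]
    [W.IsGloballyMinimal] (p : ℕ) [Fact p.Prime] (K : Type) [Field K] [NumberField K]
    (h2 : Module.finrank ℚ K = 2) (hH : SatisfiesHeegnerHypothesis (W.conductorNorm ℤ) K) :
    padicValNat p (W.baseChange K).tamagawaProduct = 2 * padicValNat p W.tamagawaProduct := by
  haveI hEK : (W.baseChange K).IsElliptic := by rw [baseChange]; infer_instance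
  rw [X11b.Three.padicValNat_tamagawaProduct_baseChange_of_fibrewise W p K W
      (fun v => sum_fibre_padicValNat_localTamagawaNumber_of_heegner W p K h2 hH v), two_mul]

/-- **`∏_w c_w(E/K) = (∏_ℓ c_ℓ(E/ℚ))²` on a quadratic field in which every bad prime of `E`
splits** (`W/ℚ` globally minimal; the Tamagawa products of `W_K` — any `K`-model isomorphic to it
has the same product — and of `W`): the `p`-adic valuations agree at every prime
(`padicValNat_tamagawaProduct_baseChange_of_heegner`, Mathlib `Nat.eq_iff_prime_padicValNat_eq`).
Jetchev–Skinner–Wan 2017 (eq:tamK); Gross 1991 §2 uses exactly this on a Heegner field.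
[cite: JetchevSkinnerWan2017, §7.4.1 (eq:tamK) (pp. 29–31)] -/
theorem tamagawaProduct_baseChange_eq_sq_of_heegner (W : WeierstrassCurve ℚ) [W.IsElliptic]
    [W.IsGloballyMinimal] (K : Type) [Field K] [NumberField K]
    (h2 : Module.finrank ℚ K = 2) (hH : SatisfiesHeegnerHypothesis (W.conductorNorm ℤ) K) :
    (W.baseChange K).tamagawaProduct = W.tamagawaProduct ^ 2 := by
  haveI hEK : (W.baseChange K).IsElliptic := by rw [baseChange]; infer_instance
  have h0K : (W.baseChange K).tamagawaProduct ≠ 0 := (W.baseChange K).tamagawaProduct_pos'.ne'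
  have h0 : W.tamagawaProduct ≠ 0 := W.tamagawaProduct_pos'.ne'
  rw [Nat.eq_iff_prime_padicValNat_eq _ _ h0K (pow_ne_zero 2 h0)]
  intro p hp
  haveI : Fact p.Prime := ⟨hp⟩
  rw [padicValNat_tamagawaProduct_baseChange_of_heegner W p K h2 hH, padicValNat.pow]

end Summit.BirchSwinnertonDyer.BirchSwinnertonDyer.Theorems.ShaCountTwo

end
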